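import Summits.CriticalPhenomena.PercolationContinuityZ3.Theorems.PercNearOneGluingNoHeavyConstsClusterSquareOuterplanar
import HarnessLib

/-!
# CSQ, DUU and TS on outerplanar graphs, II: an arbitrary cyclic order (position map)

builds on p205010 (kernel theorem, internal audit signed; external expert review pending)

PAPER-2 track "percolation constants", part (ii), seat `prim-consts-1`, gen 19 (lane index
`run/shared/lean/prim/consts/CONSTANTS.md`, row A19; memo `FROM-prim-consts-1-g19-ROOT-CHOICE.md` §3).
Support file for the crux `NoHeavyLowerTail` (stmt-CriticalPhenomena-4575; `--supports`).  Theorems only; no sorries.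

`…ConstsClusterSquareOuterplanar.lean` proves CSQ/DUU/TS when the support graph `H` on `Fin n` is non-crossing for the STANDARD
cyclic order `0, 1, …, n-1`.  This file removes the dependence on the labelling: it suffices that `H` be non-crossing for the cyclic
order induced by ANY injective position map `pos : Fin n → Fin m` (no edges `{p,q}`, `{r,s}` with `pos p < pos r < pos q < pos s`),
i.e. that `H` be outerplanar with the vertices met in the order `pos` along the outer cycle (`Consts.tripleSplit_of_nonCrossing_pos`,
`Consts.clusterSquare_le_sq_of_nonCrossing_pos`, `Consts.sq_real_split_le_of_nonCrossing_pos`).  The proof is that of the first file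
verbatim with the cut-open position `(pos u - pos a).val` in place of `(u - a).val`; the walk-form connectivity lemmas
(`Consts.NonCrossing.walks_of_closure`, `walks_extend`) and the position lemmas (`val_sub_eq`, `rot_injective`, `rot_self`) are reused.
References: N. Gladkov, arXiv:2408.08457v2 (2024), Thm. 4.3, Def. 4.2, Lemma 3.1, Thm. 5.2; G. Chartrand, F. Harary,
Ann. Inst. H. Poincaré B 3 (1967) 433–438 (outerplanar graphs).
-/

noncomputable section

open Classical

namespace Summit.CriticalPhenomena.PercolationContinuityZ3.Theorems

open MeasureTheory Finset Literature.Probability.LatticeModels Literature.Probability.Percolation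

namespace Consts

namespace NonCrossing

variable {n m : ℕ} {pos : Fin n → Fin m}

/-- Two chords crossing in the order cut open at `pos o` cross in the cyclic order of the positions: a graph non-crossing for `pos`
has no edges `{p,q}`, `{r,s}` with `(pos p - pos o) < (pos r - pos o) < (pos q - pos o) < (pos s - pos o)` (mod `m`). [folklore] -/
theorem noncross_pos {H : SimpleGraph (Fin n)}
    (hnc : ∀ p q r s : Fin n, H.Adj p q → H.Adj r s → pos p < pos r → pos r < pos q → pos q < pos s → False) (o : Fin n)
    {p q r s : Fin n} (hpq : H.Adj p q) (hrs : H.Adj r s)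
    (h1 : (pos p - pos o).val < (pos r - pos o).val) (h2 : (pos r - pos o).val < (pos q - pos o).val)
    (h3 : (pos q - pos o).val < (pos s - pos o).val) : False := by
  have hp := (pos p).isLt; have hq := (pos q).isLt; have hr := (pos r).isLt; have hs := (pos s).isLt
  simp only [val_sub_eq] at h1 h2 h3
  have key : ((pos p : ℕ) < pos r ∧ (pos r : ℕ) < pos q ∧ (pos q : ℕ) < pos s) ∨
      ((pos r : ℕ) < pos q ∧ (pos q : ℕ) < pos s ∧ (pos s : ℕ) < pos p) ∨
      ((pos q : ℕ) < pos s ∧ (pos s : ℕ) < pos p ∧ (pos p : ℕ) < pos r) ∨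
      ((pos s : ℕ) < pos p ∧ (pos p : ℕ) < pos r ∧ (pos r : ℕ) < pos q) := by
    split_ifs at h1 h2 h3 <;> omega
  rcases key with ⟨a1, a2, a3⟩ | ⟨a1, a2, a3⟩ | ⟨a1, a2, a3⟩ | ⟨a1, a2, a3⟩
  · exact hnc p q r s hpq hrs a1 a2 a3
  · exact hnc r s q p hrs hpq.symm a1 a2 a3
  · exact hnc q p s r hpq.symm hrs.symm a1 a2 a3
  · exact hnc s r p q hrs.symm hpq a1 a2 a3

/-! ### Gaps of a connected set: the counting function -/

/- The GAP COUNT of `u ∉ S` is `#{s ∈ S | (pos s - pos o).val < (pos u - pos o).val}`, written out in full below (no definition): for `o ∈ S`, two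
vertices outside `S` have the same count iff they lie in the same gap of `S` on the cycle. -/

/-- `cnt` is monotone in the position. [folklore] -/
theorem cnt_mono_pos (o : Fin n) (S : Set (Fin n)) {u v : Fin n} (h : (pos u - pos o).val ≤ (pos v - pos o).val) :
    (Finset.univ.filter (fun s => s ∈ S ∧ (pos s - pos o).val < (pos u - pos o).val)).card ≤ (Finset.univ.filter (fun s => s ∈ S ∧ (pos s - pos o).val < (pos v - pos o).val)).card := by
  refine card_le_card fun s hs => ?_
  rw [mem_filter] at hs ⊢
  exact ⟨hs.1, hs.2.1, lt_of_lt_of_le hs.2.2 h⟩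

/-- Equal counts ⇒ no vertex of `S` strictly in between. [folklore] -/
theorem not_between_of_cnt_eq_pos (o : Fin n) (S : Set (Fin n)) {u v s : Fin n}
    (h : (Finset.univ.filter (fun s => s ∈ S ∧ (pos s - pos o).val < (pos u - pos o).val)).card = (Finset.univ.filter (fun s => s ∈ S ∧ (pos s - pos o).val < (pos v - pos o).val)).card) (hs : s ∈ S) (h1 : (pos u - pos o).val < (pos s - pos o).val) (h2 : (pos s - pos o).val < (pos v - pos o).val) : False := by
  have hlt : (Finset.univ.filter (fun s => s ∈ S ∧ (pos s - pos o).val < (pos u - pos o).val)).card < (Finset.univ.filter (fun s => s ∈ S ∧ (pos s - pos o).val < (pos v - pos o).val)).card := by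
    refine card_lt_card ((ssubset_iff_of_subset fun t ht => ?_).2 ⟨s, ?_, ?_⟩)
    · rw [mem_filter] at ht ⊢
      exact ⟨ht.1, ht.2.1, lt_trans ht.2.2 (lt_trans h1 h2)⟩
    · rw [mem_filter]; exact ⟨mem_univ _, hs, h2⟩
    · rw [mem_filter]; exact fun h' => lt_asymm h1 h'.2.2
  omega

/-- Symmetric form of `not_between_of_cnt_eq_pos`. [folklore] -/
theorem not_between_of_cnt_eq_pos' (o : Fin n) (S : Set (Fin n)) {u v s : Fin n}
    (h : (Finset.univ.filter (fun s => s ∈ S ∧ (pos s - pos o).val < (pos u - pos o).val)).card = (Finset.univ.filter (fun s => s ∈ S ∧ (pos s - pos o).val < (pos v - pos o).val)).card) (hs : s ∈ S) :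
    ¬ ((pos u - pos o).val < (pos s - pos o).val ∧ (pos s - pos o).val < (pos v - pos o).val) ∧ ¬ ((pos v - pos o).val < (pos s - pos o).val ∧ (pos s - pos o).val < (pos u - pos o).val) :=
  ⟨fun h' => not_between_of_cnt_eq_pos o S h hs h'.1 h'.2, fun h' => not_between_of_cnt_eq_pos o S h.symm hs h'.1 h'.2⟩

/-- KEY LEMMA (ordered form): for `S ∋ o` connected from `o` inside `H[S]` and a non-crossing `H`, adjacent vertices outside `S`
have the same count. [folklore: discrete Jordan curve theorem on a cycle] -/
private theorem cnt_eq_of_adj_lt_pos {H : SimpleGraph (Fin n)} {o : Fin n} (hpos : Function.Injective pos)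
    (hnc : ∀ p q r s : Fin n, H.Adj p q → H.Adj r s → (pos p - pos o).val < (pos r - pos o).val → (pos r - pos o).val < (pos q - pos o).val → (pos q - pos o).val < (pos s - pos o).val → False)
    {S : Set (Fin n)} (hS : ∀ s ∈ S, ∃ W : H.Walk o s, ∀ v ∈ W.support, v ∈ S)
    {x x' : Fin n} (hx : x ∉ S) (hx' : x' ∉ S) (hadj : H.Adj x x') (hlt : (pos x - pos o).val < (pos x' - pos o).val) :
    (Finset.univ.filter (fun s => s ∈ S ∧ (pos s - pos o).val < (pos x - pos o).val)).card = (Finset.univ.filter (fun s => s ∈ S ∧ (pos s - pos o).val < (pos x' - pos o).val)).card := by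
  by_contra hne
  -- some vertex of `S` lies strictly between `x` and `x'`
  obtain ⟨k₁, hk₁S, hk₁a, hk₁b⟩ : ∃ k₁ ∈ S, (pos x - pos o).val < (pos k₁ - pos o).val ∧ (pos k₁ - pos o).val < (pos x' - pos o).val := by
    by_contra hno
    push Not at hno
    have hsub : Finset.univ.filter (fun s => s ∈ S ∧ (pos s - pos o).val < (pos x' - pos o).val) ⊆
        Finset.univ.filter (fun s => s ∈ S ∧ (pos s - pos o).val < (pos x - pos o).val) := by
      intro s hs
      rw [mem_filter] at hs ⊢
      refine ⟨hs.1, hs.2.1, ?_⟩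
      by_contra hge
      push Not at hge
      have hne' : (pos x - pos o).val ≠ (pos s - pos o).val := fun h => hx (hpos (rot_injective (pos o) h) ▸ hs.2.1)
      exact absurd hs.2.2 (not_lt.2 (hno s hs.2.1 (lt_of_le_of_ne hge hne')))
    have h1 := card_le_card hsub
    have h2 := cnt_mono_pos o S hlt.le
    omega
  -- an `S`-walk from `k₁` to `o` leaves the interval `(x, x')` through a crossing edge
  obtain ⟨W, hW⟩ := hS k₁ hk₁S
  let A : Set (Fin n) := {v | (pos x - pos o).val < (pos v - pos o).val ∧ (pos v - pos o).val < (pos x' - pos o).val}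
  have hk₁A : k₁ ∈ A := ⟨hk₁a, hk₁b⟩
  have hoA : o ∉ A := fun h => by
    have h' : (pos x - pos o).val < (pos o - pos o).val := h.1
    rw [rot_self] at h'
    exact Nat.not_lt_zero _ h'
  obtain ⟨d, hd, hd1, hd2⟩ := W.reverse.exists_boundary_dart A hk₁A hoA
  have hvS : d.snd ∈ S := by
    refine hW _ ?_
    have := W.reverse.dart_snd_mem_support_of_mem_darts hd
    rwa [SimpleGraph.Walk.support_reverse, List.mem_reverse] at this
  have hvx : (pos d.snd - pos o).val ≠ (pos x - pos o).val := fun h => hx (hpos (rot_injective (pos o) h) ▸ hvS)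
  have hvx' : (pos d.snd - pos o).val ≠ (pos x' - pos o).val := fun h => hx' (hpos (rot_injective (pos o) h) ▸ hvS)
  have hu1 : (pos x - pos o).val < (pos d.fst - pos o).val := hd1.1
  have hu2 : (pos d.fst - pos o).val < (pos x' - pos o).val := hd1.2
  have hd2' : ¬ ((pos x - pos o).val < (pos d.snd - pos o).val ∧ (pos d.snd - pos o).val < (pos x' - pos o).val) := hd2
  rcases not_and_or.1 hd2' with hle | hle
  · exact hnc d.snd d.fst x x' d.adj.symm hadj (lt_of_le_of_ne (not_lt.1 hle) hvx) hu1 hu2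
  · exact hnc x x' d.fst d.snd hadj d.adj hu1 hu2 (lt_of_le_of_ne (not_lt.1 hle) (Ne.symm hvx'))

/-- KEY LEMMA: for `S` connected from `o` inside `H[S]` (`o ∈ S`) and a non-crossing `H`, two ADJACENT vertices outside `S` lie in the
same gap of `S`. [folklore: discrete Jordan curve theorem on a cycle] -/
theorem cnt_eq_of_adj_pos {H : SimpleGraph (Fin n)} {o : Fin n} (hpos : Function.Injective pos)
    (hnc : ∀ p q r s : Fin n, H.Adj p q → H.Adj r s → (pos p - pos o).val < (pos r - pos o).val → (pos r - pos o).val < (pos q - pos o).val → (pos q - pos o).val < (pos s - pos o).val → False)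
    {S : Set (Fin n)} (hS : ∀ s ∈ S, ∃ W : H.Walk o s, ∀ v ∈ W.support, v ∈ S)
    {x x' : Fin n} (hx : x ∉ S) (hx' : x' ∉ S) (hadj : H.Adj x x') : (Finset.univ.filter (fun s => s ∈ S ∧ (pos s - pos o).val < (pos x - pos o).val)).card = (Finset.univ.filter (fun s => s ∈ S ∧ (pos s - pos o).val < (pos x' - pos o).val)).card := by
  rcases lt_trichotomy ((pos x - pos o).val) ((pos x' - pos o).val) with hlt | heq | hgt
  · exact cnt_eq_of_adj_lt_pos hpos hnc hS hx hx' hadj hlt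
  · rw [heq]
  · exact (cnt_eq_of_adj_lt_pos hpos hnc hS hx' hx hadj.symm hgt).symm

/-- A walk avoiding `S` stays in one gap of `S`. [folklore] -/
theorem cnt_eq_of_walk_pos {H : SimpleGraph (Fin n)} {o : Fin n} (hpos : Function.Injective pos)
    (hnc : ∀ p q r s : Fin n, H.Adj p q → H.Adj r s → (pos p - pos o).val < (pos r - pos o).val → (pos r - pos o).val < (pos q - pos o).val → (pos q - pos o).val < (pos s - pos o).val → False)
    {S : Set (Fin n)} (hS : ∀ s ∈ S, ∃ W : H.Walk o s, ∀ v ∈ W.support, v ∈ S)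
    {p q : Fin n} (P : H.Walk p q) (hP : ∀ v ∈ P.support, v ∉ S) : (Finset.univ.filter (fun s => s ∈ S ∧ (pos s - pos o).val < (pos p - pos o).val)).card = (Finset.univ.filter (fun s => s ∈ S ∧ (pos s - pos o).val < (pos q - pos o).val)).card := by
  induction P with
  | nil => rfl
  | @cons u v z hadj P ih =>
    have hu : u ∉ S := hP u (SimpleGraph.Walk.start_mem_support _)
    have hv : v ∉ S := hP v (by simp)
    rw [cnt_eq_of_adj_pos hpos hnc hS hu hv hadj]
    exact ih fun t ht => hP t (by simp [ht])

/-! ### No double linkage in a non-crossing graph -/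

/-- **In a non-crossing (outerplanar) graph no `H`-connected `K ∋ a` is doubly linked to `{b, c}`**: the hypothesis `hK` of
`Consts.clusterSquare_le_sq_of_unlinked` holds for every `a, b, c`.  [folklore: Jordan curve theorem on the outer cycle; cf. the
planar common-face remark of Gladkov2024, Thm. 6.1] -/
theorem unlinked_pos (H : SimpleGraph (Fin n)) (pos : Fin n → Fin m) (hpos : Function.Injective pos)
    (hnc : ∀ p q r s : Fin n, H.Adj p q → H.Adj r s → pos p < pos r → pos r < pos q → pos q < pos s → False) (a b c : Fin n) :
    ∀ (K : Set (Fin n)) (y y' : Fin n), a ∈ K → b ∉ K → c ∉ K →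
      (∀ T : Set (Fin n), a ∈ T → (∀ u x, u ∈ T → H.Adj u x → x ∈ K → x ∈ T) → K ⊆ T) →
      y ∉ K → y' ∉ K → (∃ k, k ∈ K ∧ H.Adj k y) → (∃ k, k ∈ K ∧ H.Adj k y') →
      y ≠ a → y ≠ b → y ≠ c → y' ≠ a → y' ≠ b → y' ≠ c → y ≠ y' →
      (∀ (P₁ : H.Walk y b) (P₂ : H.Walk y' c), (∀ x ∈ P₁.support, x ∉ K) → (∀ x ∈ P₂.support, x ∉ K) →
          ∃ x, x ∈ P₁.support ∧ x ∈ P₂.support) ∨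
      (∀ (Q₁ : H.Walk y c) (Q₂ : H.Walk y' b), (∀ x ∈ Q₁.support, x ∉ K) → (∀ x ∈ Q₂.support, x ∉ K) →
          ∃ x, x ∈ Q₁.support ∧ x ∈ Q₂.support) := by
  intro K y y' haK hbK hcK hcl hyK hy'K hky hk'y' _ hyb hyc _ hy'b hy'c hyy'
  obtain ⟨k, hkK, hky⟩ := hky
  obtain ⟨k', hk'K, hk'y'⟩ := hk'y'
  by_contra h
  push Not at h
  obtain ⟨⟨P₁, P₂, hP₁, hP₂, hPd⟩, ⟨Q₁, Q₂, hQ₁, hQ₂, hQd⟩⟩ := h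
  have hncρ : ∀ p q r s : Fin n, H.Adj p q → H.Adj r s →
      (pos p - pos a).val < (pos r - pos a).val → (pos r - pos a).val < (pos q - pos a).val → (pos q - pos a).val < (pos s - pos a).val → False :=
    fun p q r s hpq hrs => noncross_pos hnc a hpq hrs
  have hKw := walks_of_closure haK hcl
  -- memberships in the four supports
  have hyP₁ : y ∈ P₁.support := P₁.start_mem_support
  have hbP₁ : b ∈ P₁.support := P₁.end_mem_support
  have hy'P₂ : y' ∈ P₂.support := P₂.start_mem_support
  have hcP₂ : c ∈ P₂.support := P₂.end_mem_support
  have hyQ₁ : y ∈ Q₁.support := Q₁.start_mem_support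
  have hcQ₁ : c ∈ Q₁.support := Q₁.end_mem_support
  have hy'Q₂ : y' ∈ Q₂.support := Q₂.start_mem_support
  have hbQ₂ : b ∈ Q₂.support := Q₂.end_mem_support
  have hbc : b ≠ c := fun h => hPd b hbP₁ (h ▸ hcP₂)
  -- distinct positions
  have rbc : (pos b - pos a).val ≠ (pos c - pos a).val := fun h => hbc (hpos (rot_injective (pos a) h))
  have ryb : (pos y - pos a).val ≠ (pos b - pos a).val := fun h => hyb (hpos (rot_injective (pos a) h))
  have ryc : (pos y - pos a).val ≠ (pos c - pos a).val := fun h => hyc (hpos (rot_injective (pos a) h))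
  have ry'b : (pos y' - pos a).val ≠ (pos b - pos a).val := fun h => hy'b (hpos (rot_injective (pos a) h))
  have ry'c : (pos y' - pos a).val ≠ (pos c - pos a).val := fun h => hy'c (hpos (rot_injective (pos a) h))
  have ryy' : (pos y - pos a).val ≠ (pos y' - pos a).val := fun h => hyy' (hpos (rot_injective (pos a) h))
  -- the sets `K ∪ {y}` and `K ∪ {y'}`
  have hSy := walks_extend hKw hkK hky (SimpleGraph.Walk.nil : H.Walk y y)
  have hSy' := walks_extend hKw hk'K hk'y' (SimpleGraph.Walk.nil : H.Walk y' y')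
  have memy : ∀ v, v ∈ K ∪ {v | v ∈ (SimpleGraph.Walk.nil : H.Walk y y).support} ↔ v ∈ K ∨ v = y := fun v => by
    simp only [Set.mem_union, Set.mem_setOf_eq, SimpleGraph.Walk.support_nil, List.mem_singleton]
  have memy' : ∀ v, v ∈ K ∪ {v | v ∈ (SimpleGraph.Walk.nil : H.Walk y' y').support} ↔ v ∈ K ∨ v = y' := fun v => by
    simp only [Set.mem_union, Set.mem_setOf_eq, SimpleGraph.Walk.support_nil, List.mem_singleton]
  -- F2: w.r.t. `K ∪ {y}`, the walks `P₂ : y' → c` and `Q₂ : y' → b` avoid it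
  have F2c := cnt_eq_of_walk_pos hpos hncρ hSy P₂ fun v hv hvS => by
    rcases (memy v).1 hvS with hvK | rfl
    · exact hP₂ v hv hvK
    · exact hPd _ hyP₁ hv
  have F2b := cnt_eq_of_walk_pos hpos hncρ hSy Q₂ fun v hv hvS => by
    rcases (memy v).1 hvS with hvK | rfl
    · exact hQ₂ v hv hvK
    · exact hQd _ hyQ₁ hv
  -- F3: w.r.t. `K ∪ {y'}`, the walks `P₁ : y → b` and `Q₁ : y → c` avoid it
  have F3b := cnt_eq_of_walk_pos hpos hncρ hSy' P₁ fun v hv hvS => by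
    rcases (memy' v).1 hvS with hvK | rfl
    · exact hP₁ v hv hvK
    · exact hPd _ hv hy'P₂
  have F3c := cnt_eq_of_walk_pos hpos hncρ hSy' Q₁ fun v hv hvS => by
    rcases (memy' v).1 hvS with hvK | rfl
    · exact hQ₁ v hv hvK
    · exact hQd _ hv hy'Q₂
  have hyS : y ∈ K ∪ {v | v ∈ (SimpleGraph.Walk.nil : H.Walk y y).support} := (memy y).2 (Or.inr rfl)
  have hy'S : y' ∈ K ∪ {v | v ∈ (SimpleGraph.Walk.nil : H.Walk y' y').support} := (memy' y').2 (Or.inr rfl)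
  obtain ⟨G1, G2⟩ := not_between_of_cnt_eq_pos' a _ F2c hyS
  obtain ⟨G3, G4⟩ := not_between_of_cnt_eq_pos' a _ F2b hyS
  obtain ⟨G5, G6⟩ := not_between_of_cnt_eq_pos' a _ F3b hy'S
  obtain ⟨G7, G8⟩ := not_between_of_cnt_eq_pos' a _ F3c hy'S
  -- so `y, y'` are the extreme points of `{y, y', b, c}`; the interleaved linkage crosses the other one
  rcases Nat.lt_or_gt_of_ne ryy' with hyy | hyy
  · -- `y` is the minimum, `y'` the maximum
    rcases Nat.lt_or_gt_of_ne rbc with hbc' | hbc'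
    · -- y < b < c < y' : `Q₂ : y' → b` avoids `K ∪ supp Q₁ ∋ c`
      have hS := walks_extend hKw hkK hky Q₁
      have F := cnt_eq_of_walk_pos hpos hncρ hS Q₂ fun v hv hvS => by
        rcases hvS with hvK | hvQ
        · exact hQ₂ v hv hvK
        · exact hQd v hvQ hv
      exact not_between_of_cnt_eq_pos a _ F.symm (Or.inr hcQ₁) hbc' (by omega)
    · -- y < c < b < y' : `P₂ : y' → c` avoids `K ∪ supp P₁ ∋ b`
      have hS := walks_extend hKw hkK hky P₁
      have F := cnt_eq_of_walk_pos hpos hncρ hS P₂ fun v hv hvS => by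
        rcases hvS with hvK | hvP
        · exact hP₂ v hv hvK
        · exact hPd v hvP hv
      exact not_between_of_cnt_eq_pos a _ F.symm (Or.inr hbP₁) hbc' (by omega)
  · -- `y'` is the minimum, `y` the maximum
    rcases Nat.lt_or_gt_of_ne rbc with hbc' | hbc'
    · -- y' < b < c < y : `P₁ : y → b` avoids `K ∪ supp P₂ ∋ c`
      have hS := walks_extend hKw hk'K hk'y' P₂
      have F := cnt_eq_of_walk_pos hpos hncρ hS P₁ fun v hv hvS => by
        rcases hvS with hvK | hvP
        · exact hP₁ v hv hvK
        · exact hPd v hv hvP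
      exact not_between_of_cnt_eq_pos a _ F.symm (Or.inr hcP₂) hbc' (by omega)
    · -- y' < c < b < y : `Q₁ : y → c` avoids `K ∪ supp Q₂ ∋ b`
      have hS := walks_extend hKw hk'K hk'y' Q₂
      have F := cnt_eq_of_walk_pos hpos hncρ hS Q₁ fun v hv hvS => by
        rcases hvS with hvK | hvQ
        · exact hQ₁ v hv hvK
        · exact hQd v hv hvQ
      exact not_between_of_cnt_eq_pos a _ F.symm (Or.inr hbQ₂) hbc' (by omega)

end NonCrossing

/-! ### CSQ, DUU, TS on outerplanar graphs with an arbitrary cyclic order -/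

section Fin

variable {n m : ℕ} (w : Sym2 (Fin n) → unitInterval) (a b c : Fin n) (H : SimpleGraph (Fin n))
  (pos : Fin n → Fin m)

/-- **CSQ on every weighted outerplanar graph, arbitrary cyclic order.**  If the positive pairs of `w` lie in a graph `H` that is
non-crossing for the cyclic order of an injective position map `pos` (no edges `{p,q}`, `{r,s}` with `pos p < pos r < pos q < pos s`),
then `clusterSquare w a b c ≤ μ(b ↮ c)²` for all `a, b, c`. [cite: Gladkov2024, Thm. 4.3, Def. 4.2, Lemma 3.1, Thm. 5.2] -/
theorem clusterSquare_le_sq_of_nonCrossing_pos (hH : ∀ u v, u ≠ v → (0 : ℝ) < w s(u, v) → H.Adj u v)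
    (hpos : Function.Injective pos)
    (hnc : ∀ p q r s : Fin n, H.Adj p q → H.Adj r s → pos p < pos r → pos r < pos q → pos q < pos s → False) :
    clusterSquare w a b c ≤ (prodBernoulli w).real (openConn b c)ᶜ ^ 2 :=
  clusterSquare_le_sq_of_unlinked w a b c H hH (NonCrossing.unlinked_pos H pos hpos hnc a b c)

/-- **DUU on every weighted outerplanar graph, arbitrary cyclic order**, every root:
`μ(a↮b, a↮c, b↮c)² ≤ μ(a↮b, a↮c) · μ(b↮c)²`. [cite: Gladkov2024, Thm. 5.2 and Thm. 4.3] -/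
theorem sq_real_split_le_of_nonCrossing_pos (hH : ∀ u v, u ≠ v → (0 : ℝ) < w s(u, v) → H.Adj u v)
    (hpos : Function.Injective pos)
    (hnc : ∀ p q r s : Fin n, H.Adj p q → H.Adj r s → pos p < pos r → pos r < pos q → pos q < pos s → False) :
    (prodBernoulli w).real ((openConn a b)ᶜ ∩ (openConn a c)ᶜ ∩ (openConn b c)ᶜ) ^ 2 ≤
      (prodBernoulli w).real ((openConn a b)ᶜ ∩ (openConn a c)ᶜ) * (prodBernoulli w).real (openConn b c)ᶜ ^ 2 :=
  sq_real_split_le_of_unlinked w a b c H hH (NonCrossing.unlinked_pos H pos hpos hnc a b c)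

/-- **TS on every weighted outerplanar graph, arbitrary cyclic order**, every triple of terminals:
`μ(a↮b, a↮c, b↮c)² ≤ μ(a↮b) · μ(a↮c) · μ(b↮c)`. [cite: Gladkov2024, Thm. 5.2, Cor. 5.3 (pattern) and Thm. 4.3] -/
theorem tripleSplit_of_nonCrossing_pos (hH : ∀ u v, u ≠ v → (0 : ℝ) < w s(u, v) → H.Adj u v)
    (hpos : Function.Injective pos)
    (hnc : ∀ p q r s : Fin n, H.Adj p q → H.Adj r s → pos p < pos r → pos r < pos q → pos q < pos s → False) :
    (prodBernoulli w).real ((openConn a b)ᶜ ∩ (openConn a c)ᶜ ∩ (openConn b c)ᶜ) ^ 2 ≤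
      (prodBernoulli w).real (openConn a b)ᶜ * (prodBernoulli w).real (openConn a c)ᶜ *
        (prodBernoulli w).real (openConn b c)ᶜ :=
  tripleSplit_of_unlinked w a b c H hH (NonCrossing.unlinked_pos H pos hpos hnc a b c)

end Fin

end Consts

end Summit.CriticalPhenomena.PercolationContinuityZ3.Theorems
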